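import Literature.NumberTheory.Automorphic.SolvableBaseChangeModularity
import Literature.NumberTheory.Automorphic.AutomorphicTwistWeightOne
import Literature.NumberTheory.Automorphic.QuadraticHeckeCharacter
import Literature.NumberTheory.Automorphic.QuaternionRamificationParityHolds
import Literature.NumberTheory.Automorphic.ReciprocityGLnPotentialModularityTateProofs
import Literature.NumberTheory.EllipticCurves.QuadraticTwistLocalPolynomialProofs
import Literature.NumberTheory.EllipticCurves.ComplexMultiplicationHasCMProofs
import Literature.NumberTheory.QuadraticForms.HilbertSymbolLocal
import HarnessLib

/-!
# Twist invariance of modularity: discharge of `isModularEllipticCurve_of_jInvariant_eq`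

Sibling PROOFS file (theorems only: no definition, no named fact, no instance; D-0014 / D-0026)
of `SolvableBaseChangeModularity.lean`, discharging its second named fact:

* `isModularEllipticCurve_of_jInvariant_eq_holds : isModularEllipticCurve_of_jInvariant_eq` —
  over a totally real number field `K`, two integral models `E`, `E'` over `𝓞 K` (`Δ ≠ 0`) with
  the same `j = c₄³/Δ ∉ {0, 1728}` are modular together, in the sense of Caraiani–Newton
  (`IsModularEllipticCurve K`: geometric CM, or a weight-zero cuspidal `π` of `GL₂(𝔸_K)` with
  `q_w^{1/2}(α_w + β_w) = a_w` at almost all `w`).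

This is the inference printed in every modularity paper that meets a twist — Box 2022, §1.2
(p. 5 of the held text arXiv:2103.13975): "… or is a quadratic twist `E = E′ ⊗ χ`, where `χ` is
a quadratic character … If `E′` corresponds to the Hilbert modular form `𝔣`, then `E` is also
modular and corresponds to `𝔣 ⊗ χ`"; Freitas–Le Hung–Siksek 2015, §2 (p. 9 of arXiv:1310.7088):
curves with the same `j`-invariant `≠ 0, 1728` "are quadratic twists of each other" — assembled
here from results PROVED in the tree, with no new hypothesis:

1. *Twists.* `E' ⊗ K ≅_K (E ⊗ K)^{(d)}` for some `d ∈ Kˣ` (Silverman, *AEC*, X.5 Prop. 5.4 and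
   Cor. 5.4.1; tree `WeierstrassCurve.exists_variableChange_eq_quadraticTwist_of_j_eq`), and
   `d = θ b⁻²` with `θ ∈ 𝓞 K` (`exists_ringOfIntegers_eq_mul_sq`,
   `exists_variableChange_quadraticTwist_mul_sq`).
2. *CM branch.* Geometric CM depends only on `j` (`WeierstrassCurve.hasCM_iff_of_j_eq`).
3. *The character.* For `θ ∉ K²`, `ω = quadraticHeckeChar K θ` (the sign character of
   `P_K · N_{K(√θ)/K} J`, index `2` by the norm index theorem, O'Meara 65:21 — tree
   `QuadraticHeckeCharacter.lean`) has finite order, and at every `v ∤ 2θ`: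
   `ω(ϖ_v) = 1` if `θ ∈ K_v²` (O'Meara §65A, `valueAtUniformizer_quadraticHeckeChar_of_isSquare`)
   and `ω(ϖ_v) = -1` if `θ ∉ K_v²` (`valueAtUniformizer_quadraticHeckeChar_of_not_isSquare`: a
   local non-norm at `v` would otherwise contradict Hilbert's reciprocity law, O'Meara 71:18,
   PROVED in the tree as `hilbertReciprocity_holds`).
4. *The twist of `π`.* `π' = π ⊗ (ω ∘ det)` (`CuspidalAutomorphicRepData.twist`, Arthur–Clozel
   Ch. 3) is cuspidal of weight zero (`AutomorphicRepData.HasArchParameter.twist`) with Satake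
   parameter `ω(ϖ_w) · α_w` at almost every `w` (`AutomorphicRepData.eventually_hasSatakeParamAt_twist`).
5. *Traces.* At every `w ∤ 2 θ Δ(E) Δ(E')`, `a_w(E') = ± a_w(E)` according as `θ ∈ K_w²`
   (`frobTraceAt_eq_ite_mul_of_smul_eq_quadraticTwist`): the integral models compute `a_w` of
   their generic fibres (`frobeniusTraceAt_baseChange_eq_frobTraceAt`), `a_w` is a
   `K`-isomorphism invariant (`WeierstrassCurve.frobeniusTraceAt_smul`, from
   `localPolynomial_smul`), and for the unit twist `a_w((E ⊗ K)^{(θ)}) = χ_w(θ̄) a_w(E ⊗ K)`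
   (`WeierstrassCurve.frobeniusTraceAt_quadraticTwist`: Knapp, *Elliptic Curves*, Prop. 12.10 via
   the tree's `localPolynomial_quadraticTwist`, and Hensel's lemma
   `isSquare_of_isSquare_residue` to read `χ_w(θ̄)` as "`θ ∈ K_w²`").

So `q_w^{1/2} ω(ϖ_w)(α_w + β_w) = ω(ϖ_w) a_w(E) = a_w(E')` almost everywhere, and `π'` exhibits
`E'` as modular; if `θ ∈ K²` the same `π` serves. The hypothesis "`K` totally real" of the fact
is not used (it is the printed context).

## References

* [Box2022] J. Box, Trans. Amer. Math. Soc. 375 (2022), §1.2 (p. 5 of arXiv:2103.13975).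
* [FreitasLeHungSiksek2015] Invent. Math. 201 (2015) 159–206, §2 (p. 9), §3 (p. 21) of
  arXiv:1310.7088.
* [SilvermanAEC2009] J. H. Silverman, *The Arithmetic of Elliptic Curves*, 2nd ed., III.1
  (`j = c₄³/Δ`), VII.1 Prop. 1.3(b), X.2 Prop. 2.4, X.5 Prop. 5.4 / Cor. 5.4.1, Exercise 10.16,
  C.§16.
* [Knapp1993] A. W. Knapp, *Elliptic Curves*, Prop. 12.10 (point count of a quadratic twist).
* [ArthurClozelAMS120] J. Arthur, L. Clozel, Ann. of Math. Stud. 120 (1989), Ch. 3, proof of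
  Thm. 3.1 (p. 172) (`π ⊗ η`, `ζ_v = η(ϖ_v)`).
* [Omeara1963] O. T. O'Meara, *Introduction to quadratic forms*, §65A, 65:21, 71:17–71:18.

## Design notes

Pure-proof leaf: imports the statement file and the proved inputs listed above; nothing imports
it; no `sorry`; axioms `propext`, `Classical.choice`, `Quot.sound`.
-/

noncomputable section

open scoped NumberField Polynomial Classical
open NumberField IsDedekindDomain Filter Polynomial

/-! ### §1. Local invariants: `a_v` under `K`-isomorphism and under a unit quadratic twist -/

namespace WeierstrassCurve

variable {K : Type*} [Field K] [NumberField K]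

/-- Comparing the `T`-coefficients of `1 - A T + B T² = 1 - A' T + B' T²`. [folklore] -/
theorem eq_of_one_sub_C_mul_X_add_eq {A B A' B' : ℤ}
    (h : (1 - C A * X + C B * X ^ 2 : ℤ[X]) = 1 - C A' * X + C B' * X ^ 2) : A = A' := by
  have := congrArg (fun f : ℤ[X] => f.coeff 1) h
  simpa using this

/-- **`a_v` is a `K`-isomorphism invariant at a place of good reduction**: for an elliptic curve
`W / K` with good reduction at `v` and any admissible change of variables `C` over `K`,
`a_v(C • W) = a_v(W)` (`frobeniusTraceAt`; the local polynomial `1 - a_v T + q_v T²` is an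
isomorphism invariant, `localPolynomial_smul`, and good reduction is too,
`hasGoodReductionAt_smul_iff_holds`). Silverman, *AEC*, VII.1 Prop. 1.3(b), C.§16.
[cite: SilvermanAEC2009, VII.1 Prop. 1.3(b) and C.§16] -/
theorem frobeniusTraceAt_smul (W : WeierstrassCurve K) [W.IsElliptic] (C : VariableChange K)
    (v : HeightOneSpectrum (𝓞 K)) (hv : W.HasGoodReductionAt v) :
    (C • W).frobeniusTraceAt v = W.frobeniusTraceAt v := by
  have hv' : (C • W).HasGoodReductionAt v := (hasGoodReductionAt_smul_iff_holds v W C).2 hv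
  have h1 := localPolynomialAt_of_hasGoodReductionAt hv
  have h2 := localPolynomialAt_of_hasGoodReductionAt hv'
  have h3 : (C • W).localPolynomialAt v = W.localPolynomialAt v := by
    simp only [localPolynomialAt, baseChange, ← map_variableChange]
    exact localPolynomial_smul _ _ _
  rw [h3, h1] at h2
  exact (eq_of_one_sub_C_mul_X_add_eq h2).symm

/-- The image in `K_v` of an algebraic integer `θ ∉ v` is a `v`-adic unit (valuation `1`).
[folklore] -/
theorem valued_algebraMap_eq_one_of_not_mem {θ : 𝓞 K} {v : HeightOneSpectrum (𝓞 K)}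
    (hθ : θ ∉ v.asIdeal) :
    Valued.v (algebraMap K (v.adicCompletion K) (θ : K)) = 1 := by
  have h := HeightOneSpectrum.valuedAdicCompletion_eq_valuation' (v := v) (θ : K)
  rw [show ((θ : K) : v.adicCompletion K) = algebraMap K (v.adicCompletion K) (θ : K) from rfl] at h
  rw [h]
  exact (HeightOneSpectrum.valuation_eq_one_iff_notMem v).2 hθ

/-- For a `v`-adic unit `u ∈ 𝒪_v` at a place `v ∤ 2`: `u` is a square in `K_v` iff its residue
is a square in `k_v` (Hensel, `isSquare_of_isSquare_residue`, and reduction of a unit square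
root). [folklore] -/
theorem isSquare_coe_iff_isSquare_residue {v : HeightOneSpectrum (𝓞 K)}
    (h2 : IsUnit (2 : v.adicCompletionIntegers K)) {u : v.adicCompletionIntegers K}
    (hu : IsUnit u) :
    IsSquare (u : v.adicCompletion K) ↔
      IsSquare (IsLocalRing.residue (v.adicCompletionIntegers K) u) := by
  constructor
  · rintro ⟨a, ha⟩
    -- `a` is a `v`-adic unit
    have hu1 : Valued.v (u : v.adicCompletion K) = 1 :=
      HeightOneSpectrum.adicCompletionIntegers.isUnit_iff_valued_eq_one.1 hu
    have ha0 : a ≠ 0 := by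
      rintro rfl
      rw [mul_zero] at ha
      rw [ha, map_zero] at hu1
      exact zero_ne_one hu1
    have hva : Valued.v a = 1 := by
      have hsq : Valued.v (a ^ 2) = 1 := by rw [sq, ← ha, hu1]
      have hlog := Literature.NumberTheory.QuadraticForms.log_valuation_sq K v a
      rw [hsq, WithZero.log_one] at hlog
      have hlog0 : WithZero.log (Valued.v a) = 0 := by omega
      have hne : Valued.v a ≠ 0 := (Valuation.ne_zero_iff _).2 ha0
      rw [← WithZero.exp_log hne, hlog0, WithZero.exp_zero]
    have hamem : a ∈ v.adicCompletionIntegers K := by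
      rw [HeightOneSpectrum.mem_adicCompletionIntegers]; exact hva.le
    refine ⟨IsLocalRing.residue _ ⟨a, hamem⟩, ?_⟩
    rw [← map_mul]
    congr 1
    exact Subtype.ext ha
  · intro hsq
    have h : IsSquare u :=
      Literature.NumberTheory.QuadraticForms.isSquare_of_isSquare_residue K v h2 hu hsq
    obtain ⟨r, hr⟩ := h
    exact ⟨(r : v.adicCompletion K), by rw [hr]; rfl⟩

/-- **`a_v` of a unit quadratic twist at a good place** (number-field form of Knapp, *Elliptic
Curves*, Prop. 12.10 / Silverman, *AEC*, Exercise 10.16: `a_v(E^{(θ)}) = χ_v(θ) a_v(E)` for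
`v ∤ 2θ` of good reduction): for an elliptic curve `W / K`, `θ ∈ 𝓞 K` with `v ∤ 2θ`, and `W`,
`W^{(θ)}` of good reduction at `v`, `a_v(W^{(θ)}) = a_v(W)` if `θ` is a square in `K_v` and
`a_v(W^{(θ)}) = -a_v(W)` otherwise (the tree's `localPolynomial_quadraticTwist` over `𝒪_v`, with
Hensel's lemma to pass between `k_v` and `K_v`). [cite: Knapp1993, Prop. 12.10] -/
theorem frobeniusTraceAt_quadraticTwist (W : WeierstrassCurve K) [W.IsElliptic] {θ : 𝓞 K}
    {v : HeightOneSpectrum (𝓞 K)} (h2 : (2 : 𝓞 K) ∉ v.asIdeal) (hθ : θ ∉ v.asIdeal)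
    (hv : W.HasGoodReductionAt v) (hv' : (W.quadraticTwist (θ : K)).HasGoodReductionAt v) :
    (W.quadraticTwist (θ : K)).frobeniusTraceAt v =
      (if IsSquare (algebraMap K (v.adicCompletion K) (θ : K)) then 1 else -1) *
        W.frobeniusTraceAt v := by
  set R := v.adicCompletionIntegers K with hR
  -- `θ` and `2` as units of `𝒪_v`
  have hθ1 : Valued.v (algebraMap K (v.adicCompletion K) (θ : K)) = 1 :=
    valued_algebraMap_eq_one_of_not_mem hθ
  have hθmem : algebraMap K (v.adicCompletion K) (θ : K) ∈ R := by
    rw [hR, HeightOneSpectrum.mem_adicCompletionIntegers]; exact hθ1.le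
  set u : R := ⟨_, hθmem⟩ with hu
  have huunit : IsUnit u := HeightOneSpectrum.adicCompletionIntegers.isUnit_iff_valued_eq_one.2 hθ1
  set d : Rˣ := huunit.unit with hd
  have hdK : algebraMap R (v.adicCompletion K) d = algebraMap K (v.adicCompletion K) (θ : K) := by
    rw [hd, IsUnit.unit_spec]; rfl
  have h21 : Valued.v ((2 : R) : v.adicCompletion K) = 1 := by
    have h := valued_algebraMap_eq_one_of_not_mem (K := K) h2
    rwa [show ((2 : 𝓞 K) : K) = 2 from rfl, map_ofNat] at h
  have h2R : IsUnit (2 : R) := HeightOneSpectrum.adicCompletionIntegers.isUnit_iff_valued_eq_one.2 h21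
  -- the local polynomials of `W ⊗ K_v` and of its twist by the unit `d`
  obtain ⟨A, B, hA, hB⟩ := localPolynomial_quadraticTwist R h2R (W.baseChange (v.adicCompletion K)) d
  have htw : (W.baseChange (v.adicCompletion K)).quadraticTwist (algebraMap R (v.adicCompletion K) d) =
      (W.quadraticTwist (θ : K)).baseChange (v.adicCompletion K) := by
    rw [hdK, baseChange, baseChange, map_quadraticTwist]
  rw [htw] at hB
  have h1 := localPolynomialAt_of_hasGoodReductionAt hv
  have h1' := localPolynomialAt_of_hasGoodReductionAt hv'
  change localPolynomial R (W.baseChange (v.adicCompletion K)) = _ at h1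
  change localPolynomial R ((W.quadraticTwist (θ : K)).baseChange (v.adicCompletion K)) = _ at h1'
  rw [hA] at h1
  rw [hB] at h1'
  have hAa : A = W.frobeniusTraceAt v := eq_of_one_sub_C_mul_X_add_eq h1
  have hAa' : (if IsSquare (IsLocalRing.residue R (d : R)) then 1 else -1) * A =
      (W.quadraticTwist (θ : K)).frobeniusTraceAt v := eq_of_one_sub_C_mul_X_add_eq h1'
  rw [← hAa', hAa]
  congr 1
  have hiff : IsSquare (algebraMap K (v.adicCompletion K) (θ : K)) ↔
      IsSquare (IsLocalRing.residue R (d : R)) := by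
    rw [← hdK]
    exact isSquare_coe_iff_isSquare_residue h2R d.isUnit
  simp only [hiff]

end WeierstrassCurve

/-! ### §2. The quadratic Hecke character `ω_{K(√θ)/K}` at the places where `θ ∉ K_v²` -/

namespace Literature.NumberTheory.Automorphic

open QuadraticForms GaloisRepresentations

/-- **`I_K^v ⊄ P_K · N_{K(√θ)/K} J` at a place where `θ` is not a local square** (O'Meara 71:17 in
the form needed here, from Hilbert's reciprocity law 71:18 as PROVED in the tree,
`hilbertReciprocity_holds`): if `θ ∉ K_v²` some `t ∈ K_vˣ` is a local non-norm
(`(t, θ)_v = -1`); were `⟨t⟩_v = (γ) n` with `n` a norm idèle, the places with `(γ, θ)_𝔭 = -1`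
would be exactly `{v}` — an odd number, against reciprocity. (Verbatim the argument of
`range_localUnits_not_le_of_hilbertReciprocity`, which reads `θ ∉ K_v²` off an inert prime.)
[cite: Omeara1963, §71C Prop. 71:17 and §71D Thm. 71:18] -/
theorem not_range_localUnits_le_of_not_isSquare (K : Type) [Field K] [NumberField K] {θ : K}
    (hθ0 : θ ≠ 0) (v : HeightOneSpectrum (𝓞 K))
    (hnsq : ¬ IsSquare (algebraMap K (v.adicCompletion K) θ)) :
    ¬ ((localUnits v).range ≤ principalIdeles K ⊔ normIdeles K θ) := by
  intro hle
  classical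
  haveI : CharZero (v.adicCompletion K) :=
    charZero_of_injective_algebraMap (algebraMap K _).injective
  -- a local non-norm `t` at `v`
  have hθv : algebraMap K (v.adicCompletion K) θ ≠ 0 := (_root_.map_ne_zero _).2 hθ0
  obtain ⟨t, ht0, ht⟩ := adicCompletion_exists_hilbertSymbol_eq_neg_one_holds K v _ hθv hnsq
  have htN : Units.mk0 t ht0 ∉ quadraticNormSubgroup (v.adicCompletion K) (algebraMap K _ θ) :=
    (hilbertSymbol_eq_neg_one_iff_not_mem_quadraticNormSubgroup hθv (Units.mk0 t ht0)).1 ht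
  -- `⟨t⟩_v ∈ P ⊔ N`, read off `γ`
  have hmem : localUnits v (Units.mk0 t ht0) ∈ principalIdeles K ⊔ normIdeles K θ := hle ⟨_, rfl⟩
  obtain ⟨γ, hγ⟩ := exists_placeSymbol_eq_neg_one_iff_of_mem_sup hθ0 hmem
  have hbad : badPlaces (γ : K) θ = {Sum.inl v} := by
    ext p
    rw [mem_badPlaces_iff, hγ, Set.mem_singleton_iff]
    cases p with
    | inl v' =>
      rw [isLocalNormAt_inl]
      by_cases hv' : v' = v
      · subst hv'
        rw [ideleFiniteComponent_localUnits_self]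
        exact ⟨fun _ ↦ rfl, fun _ ↦ htN⟩
      · rw [ideleFiniteComponent_localUnits_of_ne K _ hv']
        simp only [one_mem, not_true_eq_false, Sum.inl.injEq, hv']
    | inr w =>
      rw [isLocalNormAt_inr, ideleInfiniteComponent_localUnits]
      simp only [one_mem, not_true_eq_false, reduceCtorEq]
  -- one exceptional place: odd, against Hilbert reciprocity
  have hcard := ncard_badPlaces (K := K) γ.ne_zero hθ0
  rw [hbad, Set.ncard_singleton] at hcard
  have heven := (hilbertReciprocity_holds K (γ : K) θ γ.ne_zero hθ0).2
  rw [← hcard] at heven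
  exact Nat.not_even_one heven

variable {K : Type} [Field K] [NumberField K]

/-- **`ω(ϖ_v) = -1` where `θ` is not a local square** (`v ∤ 2θ`): the quadratic Hecke character
`ω = quadraticHeckeChar K θ` of `K(√θ)/K` takes the value `-1` at a uniformizer of every place
`v ∤ 2θ` with `θ ∉ K_v²` (Arthur–Clozel: "`ζ_v = η(ϖ_v)` … a root of unity of order `f_v`",
`f_v = 2` at an inert `v`), by `valueAtUniformizer_quadraticHeckeChar_of_not_le` and
`not_range_localUnits_le_of_not_isSquare`.
[cite: ArthurClozelAMS120, Ch. 3, proof of Thm. 3.1 (p. 172)] -/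
theorem valueAtUniformizer_quadraticHeckeChar_of_not_isSquare {θ : 𝓞 K}
    (hθ : ¬ IsSquare (θ : K)) {v : HeightOneSpectrum (𝓞 K)} (h2 : (2 : 𝓞 K) ∉ v.asIdeal)
    (hv : θ ∉ v.asIdeal) (hnsq : ¬ IsSquare (algebraMap K (v.adicCompletion K) (θ : K))) :
    (quadraticHeckeChar K θ hθ).valueAtUniformizer v = -1 :=
  valueAtUniformizer_quadraticHeckeChar_of_not_le hθ h2 hv
    (not_range_localUnits_le_of_not_isSquare K
      (by exact_mod_cast RingOfIntegers.ne_zero_of_not_isSquare K hθ) v hnsq)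

/-- **`ω(ϖ_v) = ±1` according as `θ ∈ K_v²` or not** (`v ∤ 2θ`), as a single formula.
[cite: ArthurClozelAMS120, Ch. 3, proof of Thm. 3.1 (p. 172)] -/
theorem valueAtUniformizer_quadraticHeckeChar_eq_ite {θ : 𝓞 K} (hθ : ¬ IsSquare (θ : K))
    {v : HeightOneSpectrum (𝓞 K)} (h2 : (2 : 𝓞 K) ∉ v.asIdeal) (hv : θ ∉ v.asIdeal) :
    (quadraticHeckeChar K θ hθ).valueAtUniformizer v =
      (((if IsSquare (algebraMap K (v.adicCompletion K) (θ : K)) then 1 else -1 : ℤ)) : ℂ) := by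
  split_ifs with hsq
  · rw [valueAtUniformizer_quadraticHeckeChar_of_isSquare hθ hsq, Int.cast_one]
  · rw [valueAtUniformizer_quadraticHeckeChar_of_not_isSquare hθ h2 hv hsq, Int.cast_neg,
      Int.cast_one]

/-! ### §3. Integral models with the same `j`-invariant: `a_w(E') = ω(ϖ_w) a_w(E)` almost everywhere -/

omit [NumberField K] in
/-- The base change to `K` of an integral model with `Δ ≠ 0` is an elliptic curve. [folklore] -/
theorem isElliptic_baseChange_of_Δ_ne_zero {E : WeierstrassCurve (𝓞 K)} (hΔ : E.Δ ≠ 0) :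
    (E.baseChange K).IsElliptic := by
  rw [WeierstrassCurve.isElliptic_iff, WeierstrassCurve.baseChange, WeierstrassCurve.map_Δ]
  exact ((map_ne_zero_iff _ (FaithfulSMul.algebraMap_injective (𝓞 K) K)).2 hΔ).isUnit

omit [NumberField K] in
/-- The `j`-invariant of `E ⊗ K` is `c₄(E)³ / Δ(E)` read in `K` (Silverman, *AEC*, III.1).
[folklore] -/
theorem j_baseChange_eq_c₄_pow_div {E : WeierstrassCurve (𝓞 K)} (hΔ : E.Δ ≠ 0) :
    (letI := isElliptic_baseChange_of_Δ_ne_zero hΔ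
     (E.baseChange K).j) = (algebraMap (𝓞 K) K E.c₄) ^ 3 / algebraMap (𝓞 K) K E.Δ := by
  letI := isElliptic_baseChange_of_Δ_ne_zero hΔ
  have hc : (E.baseChange K).c₄ = algebraMap (𝓞 K) K E.c₄ := by
    rw [WeierstrassCurve.baseChange, WeierstrassCurve.map_c₄]
  have hd : (E.baseChange K).Δ = algebraMap (𝓞 K) K E.Δ := by
    rw [WeierstrassCurve.baseChange, WeierstrassCurve.map_Δ]
  rw [WeierstrassCurve.j, Units.val_inv_eq_inv_val, WeierstrassCurve.coe_Δ', hc, hd,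
    div_eq_mul_inv, mul_comm]

/-- **`a_w(E') = ± a_w(E)` for integral models that differ by a quadratic twist over `K`.** Let
`E`, `E'` be integral models over `𝓞 K` (`Δ ≠ 0`) whose generic fibres satisfy
`C • (E' ⊗ K) = (E ⊗ K)^{(θ)}` for some `θ ∈ 𝓞 K` and a change of variables `C` over `K`. Then
at every place `w ∤ 2 θ Δ(E) Δ(E')`: `a_w(E') = a_w(E)` if `θ ∈ K_w²` and `a_w(E') = -a_w(E)`
otherwise (`frobTraceAt`, the point counts of `E mod w`, `E' mod w`): both models have good
reduction at `w` and compute `a_w` of their generic fibres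
(`frobeniusTraceAt_baseChange_eq_frobTraceAt`), `a_w` is a `K`-isomorphism invariant
(`frobeniusTraceAt_smul`) and `a_w((E ⊗ K)^{(θ)}) = ±a_w(E ⊗ K)`
(`frobeniusTraceAt_quadraticTwist`). This is "`a_𝔭(E ⊗ χ) = χ(𝔭) a_𝔭(E)`" (Silverman, *AEC*,
X.2, X.5, Exercise 10.16; Knapp, Prop. 12.10) for the tree's integral-model trace.
[cite: Knapp1993, Prop. 12.10] -/
theorem frobTraceAt_eq_ite_mul_of_smul_eq_quadraticTwist {E E' : WeierstrassCurve (𝓞 K)}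
    (hΔ : E.Δ ≠ 0) (hΔ' : E'.Δ ≠ 0) {θ : 𝓞 K} {C : WeierstrassCurve.VariableChange K}
    (hC : C • E'.baseChange K = (E.baseChange K).quadraticTwist (θ : K))
    {w : HeightOneSpectrum (𝓞 K)} (hw : E.Δ ∉ w.asIdeal) (hw' : E'.Δ ∉ w.asIdeal)
    (h2 : (2 : 𝓞 K) ∉ w.asIdeal) (hθw : θ ∉ w.asIdeal) :
    frobTraceAt E' w =
      (if IsSquare (algebraMap K (w.adicCompletion K) (θ : K)) then 1 else -1) *
        frobTraceAt E w := by
  haveI := isElliptic_baseChange_of_Δ_ne_zero hΔ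
  haveI := isElliptic_baseChange_of_Δ_ne_zero hΔ'
  have hgood : (E.baseChange K).HasGoodReductionAt w := hasGoodReductionAt_baseChange_of_Δ_not_mem hw
  have hgood' : (E'.baseChange K).HasGoodReductionAt w :=
    hasGoodReductionAt_baseChange_of_Δ_not_mem hw'
  have hgoodT : ((E.baseChange K).quadraticTwist (θ : K)).HasGoodReductionAt w := by
    rw [← hC]
    exact (WeierstrassCurve.hasGoodReductionAt_smul_iff_holds w _ C).2 hgood'
  rw [← frobeniusTraceAt_baseChange_eq_frobTraceAt hw, ← frobeniusTraceAt_baseChange_eq_frobTraceAt hw',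
    ← WeierstrassCurve.frobeniusTraceAt_smul (E'.baseChange K) C w hgood', hC]
  exact WeierstrassCurve.frobeniusTraceAt_quadraticTwist (E.baseChange K) h2 hθw hgood hgoodT


/-! ### §4. Twist invariance of modularity -/

/-- An element of a number field is an algebraic integer times the inverse square of a non-zero
element: `d = θ / b²` with `θ ∈ 𝓞 K`, i.e. `θ = d b²` (write `d = a / b`, `θ = a b`). [folklore] -/
theorem exists_ringOfIntegers_eq_mul_sq (d : K) :
    ∃ (θ : 𝓞 K) (b : K), b ≠ 0 ∧ (θ : K) = d * b ^ 2 := by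
  obtain ⟨a, b, hb, rfl⟩ := IsFractionRing.div_surjective (A := 𝓞 K) d
  have hb0 : (b : K) ≠ 0 := by
    exact_mod_cast nonZeroDivisors.ne_zero hb
  refine ⟨a * b, b, hb0, ?_⟩
  push_cast
  field_simp

/-- **Twist invariance of modularity — discharge of the named fact
`isModularEllipticCurve_of_jInvariant_eq`** (Box 2022, §1.2: "if `E′` corresponds to the Hilbert
modular form `𝔣`, then `E = E′ ⊗ χ` is also modular and corresponds to `𝔣 ⊗ χ`";
Freitas–Le Hung–Siksek 2015, §§2–3: curves with the same `j ∉ {0, 1728}` "are quadratic twists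
of each other"). Over a totally real number field `K`, let `E`, `E'` be integral models with
`Δ ≠ 0` and the same `j = c₄³/Δ ∉ {0, 1728}`, and suppose `E` is modular
(`IsModularEllipticCurve K E`). *Proof.* `E' ⊗ K ≅_K (E ⊗ K)^{(d)}` for some `d ∈ Kˣ`
(Silverman X.5.4, the tree's `exists_variableChange_eq_quadraticTwist_of_j_eq`), and we may take
`d = θ ∈ 𝓞 K` (twists depend on `d` modulo squares). If `E` has geometric CM so does `E'` (same
`j`, `hasCM_iff_of_j_eq`). Otherwise let `π` be the weight-zero cuspidal representation with
`q_w^{1/2}(α_w + β_w) = a_w(E)` for almost all `w`. If `θ ∈ K²` then `E' ⊗ K ≅_K E ⊗ K` and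
`a_w(E') = a_w(E)` at almost all `w`, so `π` serves `E'`. If not, let `ω = ω_{K(√θ)/K}` be the
quadratic Hecke character (`quadraticHeckeChar`, from the norm index theorem) and
`π' = π ⊗ (ω ∘ det)` (`CuspidalAutomorphicRepData.twist`): `π'` is cuspidal of weight zero
(`HasArchParameter.twist`), has Satake parameter `ω(ϖ_w) α_w` at almost every `w`
(`eventually_hasSatakeParamAt_twist`), and `ω(ϖ_w) = ±1` according as `θ ∈ K_w²` or not
(`valueAtUniformizer_quadraticHeckeChar_eq_ite`: O'Meara §65A and 71:17, i.e. Hilbert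
reciprocity, all proved in the tree), while `a_w(E') = ±a_w(E)` with the same sign
(`frobTraceAt_eq_ite_mul_of_smul_eq_quadraticTwist`: Knapp, Prop. 12.10 with Hensel's lemma);
hence `q_w^{1/2} · ω(ϖ_w)(α_w + β_w) = a_w(E')` for almost all `w`. ∎
[cite: Box2022, §1.2] [cite: FreitasLeHungSiksek2015, §2 and §3]
[cite: SilvermanAEC2009, X.5 Prop. 5.4 and Cor. 5.4.1] -/
theorem isModularEllipticCurve_of_jInvariant_eq_holds : isModularEllipticCurve_of_jInvariant_eq := by
  intro K _ _ _ E E' hΔ hΔ' hj hj0 hj1728 hE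
  haveI hW : (E.baseChange K).IsElliptic := isElliptic_baseChange_of_Δ_ne_zero hΔ
  haveI hW' : (E'.baseChange K).IsElliptic := isElliptic_baseChange_of_Δ_ne_zero hΔ'
  have hjE : (E.baseChange K).j = (algebraMap (𝓞 K) K E.c₄) ^ 3 / algebraMap (𝓞 K) K E.Δ :=
    j_baseChange_eq_c₄_pow_div hΔ
  have hjE' : (E'.baseChange K).j = (algebraMap (𝓞 K) K E'.c₄) ^ 3 / algebraMap (𝓞 K) K E'.Δ :=
    j_baseChange_eq_c₄_pow_div hΔ'
  have hjj : (E'.baseChange K).j = (E.baseChange K).j := by rw [hjE, hjE', hj]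
  have hj0' : (E.baseChange K).j ≠ 0 := by rwa [hjE]
  have hj1728' : (E.baseChange K).j ≠ 1728 := by rwa [hjE]
  rcases hE with hCM | ⟨hF, π, hπ0, hπ⟩
  · -- geometric CM is a function of `j`
    exact Or.inl ((WeierstrassCurve.hasCM_iff_of_j_eq hjj).2 hCM)
  -- `E' ⊗ K` is a quadratic twist of `E ⊗ K` by an algebraic integer `θ`
  obtain ⟨d, hd0, C₀, hC₀⟩ :=
    WeierstrassCurve.exists_variableChange_eq_quadraticTwist_of_j_eq hjj hj0' hj1728'
  obtain ⟨θ, b, hb0, hθ⟩ := exists_ringOfIntegers_eq_mul_sq d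
  have hθ0 : θ ≠ 0 := by
    intro h
    rw [h] at hθ
    push_cast at hθ
    exact mul_ne_zero hd0 (pow_ne_zero 2 hb0) hθ.symm
  obtain ⟨C₁, hC₁⟩ := (E.baseChange K).exists_variableChange_quadraticTwist_mul_sq d b hb0
  have hC : (C₁ * C₀) • E'.baseChange K = (E.baseChange K).quadraticTwist (θ : K) := by
    rw [mul_smul, hC₀, hC₁, hθ]
  -- the places to discard: `w ∣ 2 θ Δ(E) Δ(E')`
  have hS : ∀ᶠ w : HeightOneSpectrum (𝓞 K) in cofinite,
      E.Δ ∉ w.asIdeal ∧ E'.Δ ∉ w.asIdeal ∧ (2 : 𝓞 K) ∉ w.asIdeal ∧ θ ∉ w.asIdeal := by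
    filter_upwards [eventually_not_mem_asIdeal hΔ, eventually_not_mem_asIdeal hΔ',
      eventually_not_mem_asIdeal (two_ne_zero (α := 𝓞 K)), eventually_not_mem_asIdeal hθ0]
      with w h₁ h₂ h₃ h₄
    exact ⟨h₁, h₂, h₃, h₄⟩
  by_cases hsqK : IsSquare (θ : K)
  · -- `θ ∈ K²`: `E' ⊗ K ≅ E ⊗ K`, the same `π` serves
    refine Or.inr ⟨hF, π, hπ0, ?_⟩
    filter_upwards [hπ, hS] with w hw hSw
    obtain ⟨α, hα, hsum⟩ := hw
    obtain ⟨h₁, h₂, h₃, h₄⟩ := hSw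
    refine ⟨α, hα, ?_⟩
    have hsq : IsSquare (algebraMap K (w.adicCompletion K) (θ : K)) := hsqK.map _
    rw [hsum, frobTraceAt_eq_ite_mul_of_smul_eq_quadraticTwist hΔ hΔ' hC h₁ h₂ h₃ h₄, if_pos hsq,
      one_mul]
  · -- `θ ∉ K²`: twist `π` by the quadratic character of `K(√θ)/K`
    set χ := quadraticHeckeChar K θ hsqK with hχdef
    have hχ : χ.IsFiniteOrder := isFiniteOrder_quadraticHeckeChar hsqK
    refine Or.inr ⟨hF, π.twist χ hχ,
      ⟨hπ0.1, AutomorphicRepData.HasArchParameter.twist π.1 χ hχ hπ0.2⟩, ?_⟩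
    filter_upwards [hπ, π.1.eventually_hasSatakeParamAt_twist hχ, hS] with w hw htw hSw
    obtain ⟨α, hα, hsum⟩ := hw
    obtain ⟨h₁, h₂, h₃, h₄⟩ := hSw
    refine ⟨α.map (χ.valueAtUniformizer w * ·), htw α hα, ?_⟩
    rw [Multiset.sum_map_mul_left, Multiset.map_id', mul_left_comm, hsum,
      frobTraceAt_eq_ite_mul_of_smul_eq_quadraticTwist hΔ hΔ' hC h₁ h₂ h₃ h₄,
      valueAtUniformizer_quadraticHeckeChar_eq_ite hsqK h₃ h₄]
    push_cast
    ring

end Literature.NumberTheory.Automorphic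

end
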